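import Summits.KontsevichZagierPeriods.KontsevichZagierPeriods.Theorems.RootDecompWalshStrataCutBall4Base

/-!
# Root decomposition on Walsh strata — part 110 (gen 13, addendum 1): the wide cap `K_i(ρ)`, `ρ ≤ 4` — base

Crux `QuadricSignKernel` (item 25393), slice `d = 4`; notation of parts 104–107.  For `ρ > 2` the
cap `K_0(ρ) = {x | xⱼ > 0, x₀ ≥ 1, Σxⱼ² < ρ}` no longer fits the chart of part 105: its shadow
`T(ρ)` has `y₁ < √(ρ−1) > 1` and its fibre radius² `ρ − (1+y)² − y₁² ≤ ρ − 1` exceeds `1`, while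
`ConicDescent.lenRep`/`bandRep` live in the unit cube.  This part RESCALES: the base is read in the
coordinates `(y, y₁) = (x₀ − 1, x₁/2)`, `T♯(ρ) = {y ≥ 0, y₁ > 0, (1+y)² + 4y₁² < ρ} ⊆ [0,1]²`
(`ρ ≤ 4`), with the quarter fibre radius² `g♯ = (ρ − (1+y)² − 4y₁²)/4 ≤ 3/4` and the planar
representation `tRepH = [T♯(ρ), 8q·g♯]` (the weight `8q·g♯ = 2q·s²` is the Jacobian `2s²` of the
chart `(1 + y, 2y₁, s·u)` of part 111 times `q`).  Also: `capRepW = [K_i(ρ), q]` for `ρ ≤ 4`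
(bounded in `[0,2]⁴`) and its agreement with `capRep` of part 104 on `ρ ≤ 2`.
[KontsevichZagier2001 §1.1, §4.1; BCR1998 §2.1]
-/

noncomputable section

open Literature.NumberTheory.Transcendental
open MeasureTheory Set
open MvPolynomial (aeval X C)
open Literature.ModelTheory.ExponentialFields (IsSemialgebraic isSemialgebraic_setOf_eval_pos
  isSemialgebraic_setOf_eval_nonneg isSemialgebraic_setOf_eval_lt)
open Summit.KontsevichZagierPeriods.RootDecompWalshStrata.WalshSpanProof (cellRep cellRep_domain
  cellRep_integrand)
open Summit.KontsevichZagierPeriods.RootDecompWalshStrata.ConeSpecimen (discPoly aeval_discPoly)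
open Summit.KontsevichZagierPeriods.RootDecompWalshStrata.ConicDescent (bddRep bddRep_domain bddRep_integrand
  lenRep)

namespace Summit.KontsevichZagierPeriods.RootDecompWalshStrata.CutBall4

variable {ρ : ℚ}

/-! #### The caps for `ρ ≤ 4` -/

/-- A cap lies in the box `[0, 2]⁴` when `ρ ≤ 4` (`xⱼ² < ρ ≤ 4`). [folklore] -/
theorem capSet_subset_Icc_of_le_four (h4 : ρ ≤ 4) (i : Fin 4) : capSet ρ i ⊆ Icc 0 2 := by
  intro x hx
  obtain ⟨hpos, -, hn⟩ := hx
  have h4' : (ρ : ℝ) ≤ 4 := by exact_mod_cast h4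
  rw [nsq] at hn
  have h0 := hpos 0; have h1 := hpos 1; have hx2 := hpos 2; have hx3 := hpos 3
  refine ⟨fun j => (hpos j).le, fun j => ?_⟩
  fin_cases j <;> simp <;> nlinarith

/-- The caps are bounded (`ρ ≤ 4`). [folklore] -/
theorem isBounded_capSet_of_le_four (h4 : ρ ≤ 4) (i : Fin 4) : Bornology.IsBounded (capSet ρ i) :=
  (isCompact_Icc (a := (0 : Fin 4 → ℝ)) (b := 2)).isBounded.subset (capSet_subset_Icc_of_le_four h4 i)

/-- **`capRepW ρ q i = [K_i(ρ), q]`**, the cap with constant rational weight `q`, for every `ρ ≤ 4`.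
[KontsevichZagier2001 §1.1] -/
def capRepW (ρ q : ℚ) (h4 : ρ ≤ 4) (i : Fin 4) : KZ.IntegralRep 4 :=
  bddRep (capSet ρ i) (isSemialgebraic_capSet ρ i) (isBounded_capSet_of_le_four h4 i) (fun _ => (q : ℝ))
    (isSemialgebraicFunOn_ratCast (isSemialgebraic_capSet ρ i) q) |(q : ℝ)| fun _ _ => le_rfl

/-- The domain of `capRepW`. [definition] -/
@[simp] theorem capRepW_domain (q : ℚ) (h4 : ρ ≤ 4) (i : Fin 4) :
    (capRepW ρ q h4 i).domain = capSet ρ i := rfl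

/-- The integrand of `capRepW`. [definition] -/
@[simp] theorem capRepW_integrand (q : ℚ) (h4 : ρ ≤ 4) (i : Fin 4) (x : Fin 4 → ℝ) :
    (capRepW ρ q h4 i).integrand x = (q : ℝ) := rfl

/-- `capRepW` agrees with `capRep` of part 104 where both are defined (`ρ ≤ 2`):
`[capRepW] − [capRep] ∈ relations`. [KontsevichZagier2001 §1.2] -/
theorem of_capRepW_sub_of_capRep_mem_relations (q : ℚ) (h2 : ρ ≤ 2) (h4 : ρ ≤ 4) (i : Fin 4) :
    KZ.of (capRepW ρ q h4 i) - KZ.of (capRep ρ q h2 i) ∈ KZ.relations :=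
  KZ.of_sub_of_mem_relations_of_eqOn (by rw [capRepW_domain, capRep_domain])
    fun x _ => by rw [capRepW_integrand, capRep_integrand]

/-! #### The rescaled base `T♯(ρ)` and the planar representation `tRepH` -/

/-- `T♯(ρ) = {(y, y₁) | 0 ≤ y, 0 < y₁, (1 + y)² + 4y₁² < ρ}` — the cap's shadow in the coordinates
`(x₀ − 1, x₁/2)`. -/
def tSetH (ρ : ℚ) : Set (Fin 2 → ℝ) := {y | 0 ≤ y 0 ∧ 0 < y 1 ∧ (1 + y 0) ^ 2 + 4 * y 1 ^ 2 < ρ}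

/-- Membership in `T♯(ρ)`, unfolded. [definition] -/
theorem mem_tSetH {y : Fin 2 → ℝ} :
    y ∈ tSetH ρ ↔ 0 ≤ y 0 ∧ 0 < y 1 ∧ (1 + y 0) ^ 2 + 4 * y 1 ^ 2 < ρ := Iff.rfl

/-- `T♯(ρ)` is `ℚ`-semialgebraic. [BCR1998 §2.1] -/
theorem isSemialgebraic_tSetH (ρ : ℚ) : IsSemialgebraic ℚ (tSetH ρ) := by
  have h0 : IsSemialgebraic ℚ {y : Fin 2 → ℝ | 0 ≤ aeval y (X 0 : MvPolynomial (Fin 2) ℚ)} :=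
    isSemialgebraic_setOf_eval_nonneg _
  have h1 : IsSemialgebraic ℚ {y : Fin 2 → ℝ | 0 < aeval y (X 1 : MvPolynomial (Fin 2) ℚ)} :=
    isSemialgebraic_setOf_eval_pos _
  have h3 : IsSemialgebraic ℚ {y : Fin 2 → ℝ |
      aeval y ((1 + X 0) ^ 2 + 4 * X 1 ^ 2 : MvPolynomial (Fin 2) ℚ) <
        aeval y (C ρ : MvPolynomial (Fin 2) ℚ)} :=
    isSemialgebraic_setOf_eval_lt _ _
  convert (h0.inter h1).inter h3 using 1
  ext y
  simp only [tSetH, mem_inter_iff, mem_setOf_eq, map_add, map_mul, map_pow, map_one,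
    MvPolynomial.aeval_X, MvPolynomial.aeval_C, eq_ratCast, map_ofNat]
  tauto

/-- `T♯(ρ) ⊆ [0, 1]²` when `ρ ≤ 4` (`(1+y)² < 4 ⇒ y < 1`; `4y₁² < 4 ⇒ y₁ < 1`). [folklore] -/
theorem tSetH_subset_Icc (h4 : ρ ≤ 4) : tSetH ρ ⊆ Icc 0 1 := by
  intro y hy
  obtain ⟨h0, h1, hr⟩ := hy
  have h4' : (ρ : ℝ) ≤ 4 := by exact_mod_cast h4
  refine ⟨fun j => ?_, fun j => ?_⟩ <;> fin_cases j <;> simp <;> nlinarith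

/-- The quarter fibre radius squared over the rescaled base: `g♯(y, y₁) = (ρ − (1 + y)² − 4y₁²)/4`. -/
def gH (ρ : ℚ) (y : Fin 2 → ℝ) : ℝ := ((ρ : ℝ) - (1 + y 0) ^ 2 - 4 * y 1 ^ 2) / 4

/-- `g♯ > 0` on `T♯(ρ)`. [definition] -/
theorem gH_pos {y : Fin 2 → ℝ} (hy : y ∈ tSetH ρ) : 0 < gH ρ y := by
  rw [gH]; linarith [hy.2.2]

/-- `g♯ ≤ 1` everywhere when `ρ ≤ 4` (on `T♯(ρ)` indeed `≤ 3/4`). [folklore] -/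
theorem gH_le_one (h4 : ρ ≤ 4) (y : Fin 2 → ℝ) : gH ρ y ≤ 1 := by
  have h4' : (ρ : ℝ) ≤ 4 := by exact_mod_cast h4
  rw [gH]; nlinarith [sq_nonneg (1 + y 0), sq_nonneg (y 1)]

/-- `g♯` is a `ℚ`-polynomial function on any `ℚ`-semialgebraic planar set. [BCR1998 §2.2] -/
theorem isSemialgebraicFunOn_gH {S : Set (Fin 2 → ℝ)} (hS : IsSemialgebraic ℚ S) :
    IsSemialgebraicFunOn ℚ S (gH ρ) :=
  (isSemialgebraicFunOn_aeval hS
      (C (1 / 4) * (C ρ - (1 + X 0) ^ 2 - 4 * X 1 ^ 2) : MvPolynomial (Fin 2) ℚ)).congr fun y _ => by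
    simp only [gH, map_sub, map_add, map_mul, map_pow, map_one, MvPolynomial.aeval_X,
      MvPolynomial.aeval_C, eq_ratCast, map_ofNat]
    push_cast
    ring

/-- **`tRepH ρ q = [T♯(ρ), 8q·g♯]`** — a RATIONAL planar representation with polynomial weight (the
length representation of the band `0 < t < g♯(y, y₁)` over `T♯(ρ)` with weight `8q`), `ρ ≤ 4`.
[KontsevichZagier2001 §1.1] -/
def tRepH (ρ q : ℚ) (h4 : ρ ≤ 4) : KZ.IntegralRep 2 :=
  lenRep (tSetH ρ) (isSemialgebraic_tSetH ρ) (tSetH_subset_Icc h4) (fun _ => (0 : ℝ)) (gH ρ)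
    (isSemialgebraicFunOn_zero (isSemialgebraic_tSetH ρ)) (isSemialgebraicFunOn_gH (isSemialgebraic_tSetH ρ))
    (fun _ _ => le_rfl) (fun _ hy => (gH_pos hy).le) (fun y _ => gH_le_one h4 y) (8 * q)

/-- The domain of `tRepH`. [definition] -/
@[simp] theorem tRepH_domain (q : ℚ) (h4 : ρ ≤ 4) : (tRepH ρ q h4).domain = tSetH ρ := rfl

/-- The integrand of `tRepH`. [definition] -/
@[simp] theorem tRepH_integrand (q : ℚ) (h4 : ρ ≤ 4) (y : Fin 2 → ℝ) :
    (tRepH ρ q h4).integrand y = ((8 * q : ℚ) : ℝ) * (gH ρ y - 0) := rfl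

/-! #### The source: `tRepH × (unit quarter disc)` -/

/-- The source of the wide cap chart: the product of `tRepH ρ q` with the unit quarter disc
`[(0,1)² ∩ {u₀² + u₁² < 1}, 1]` (dimension `2 + 2`). [KontsevichZagier2001 §4.1] -/
def srcRepH (ρ q : ℚ) (h4 : ρ ≤ 4) : KZ.IntegralRep (2 + 2) := (tRepH ρ q h4).prod (cellRep discPoly 1)

/-- Membership in the source domain, in coordinates `z = (y, y₁, u₀, u₁)`. [definition] -/
theorem mem_srcH_iff (q : ℚ) (h4 : ρ ≤ 4) {z : Fin (2 + 2) → ℝ} :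
    z ∈ (srcRepH ρ q h4).domain ↔
      (0 ≤ z 0 ∧ 0 < z 1 ∧ (1 + z 0) ^ 2 + 4 * z 1 ^ 2 < ρ) ∧
        ((0 < z 2 ∧ z 2 < 1) ∧ (0 < z 3 ∧ z 3 < 1)) ∧ z 2 ^ 2 + z 3 ^ 2 < 1 := by
  have hD : (fun j : Fin 2 => z (Fin.natAdd 2 j)) ∈ (cellRep discPoly 1).domain ↔
      ((0 < z 2 ∧ z 2 < 1) ∧ (0 < z 3 ∧ z 3 < 1)) ∧ 0 < 1 - z 2 ^ 2 - z 3 ^ 2 := by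
    rw [cellRep_domain, mem_setOf_eq, Fin.forall_fin_two, aeval_discPoly]
    exact Iff.rfl
  change ((0 ≤ z 0 ∧ 0 < z 1 ∧ (1 + z 0) ^ 2 + 4 * z 1 ^ 2 < (ρ : ℝ)) ∧
    (fun j : Fin 2 => z (Fin.natAdd 2 j)) ∈ (cellRep discPoly 1).domain) ↔ _
  rw [hD]
  constructor
  · rintro ⟨hT, hc, hd⟩
    exact ⟨hT, hc, by linarith⟩
  · rintro ⟨hT, hc, hd⟩
    exact ⟨hT, hc, by linarith⟩

/-- The integrand of the source is `q · 2(ρ − (1+y)² − 4y₁²)` (`= 8q·g♯`). [KontsevichZagier2001 §4.1] -/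
theorem srcRepH_integrand (q : ℚ) (h4 : ρ ≤ 4) (z : Fin (2 + 2) → ℝ) :
    (srcRepH ρ q h4).integrand z = (q : ℝ) * (2 * ((ρ : ℝ) - (1 + z 0) ^ 2 - 4 * z 1 ^ 2)) := by
  rw [srcRepH, KZ.IntegralRep.prod_integrand_eq, KZ.IntegralRep.prodFun_apply, tRepH_integrand,
    cellRep_integrand]
  change ((8 * q : ℚ) : ℝ) * ((((ρ : ℝ) - (1 + z 0) ^ 2 - 4 * z 1 ^ 2) / 4) - 0) * ((1 : ℚ) : ℝ) = _
  push_cast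
  ring

end Summit.KontsevichZagierPeriods.RootDecompWalshStrata.CutBall4

end
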